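/-
Copyright (c) 2026 the pub-hodgecm-mathlib formalisation cell (harness21).  Prover seat hodgecm-mathlib-K2E2-p12 (g9), Track B «K2-LIT», h413 = `stmt-HodgeConjecture-24833`,
R90-TF section S8 «ContSpec-n½», deal S8-R202 (S8 dealer R90-CS-plan (g3)): R7₃ ON-AXIS REAL POLE LEDGER, FILE A — the ★ middle-pole Maass–Selberg chain RUN AT A REGULAR POINT:
the truncated `L²` family is BOUNDED near every `z₀` with `1 < Re z₀` at which the continued first scalar `w` is analytic (and real on the real trace) and the diagonal kernel is bounded
(census `R90/S8/CENSUS-R7RealAxis.K2E2-p12-g9.md` 886798f0b76d460b).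
-/
import Summits.HodgeConjecture.HodgeConjecture.Theorems.K2E1ChiResidueNormSqOfTubeCMThree        -- ★ p863403 (K2E1-p16): the composed middle-pole chain; brings ★ p862892 `msRel_of_tube_letters`, ★ p862829 `norm_chiFourTerm_le`, ★ FILE 1 `exists_norm_outer_le` ∕ `exists_abs_im_div_le` ∕ `eventually_norm_le_of_im_ne_zero`
import Summits.HodgeConjecture.HodgeConjecture.Theorems.K2E1ChiMaassSelbergTubeFreeCMThree        -- ★ p863423 (this seat): `maassSelberg_chiPair_cm_three_self_free` (the χ-pair tube formula, decay-letter free)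
import HarnessLib

/-!
# h413 ∕ R90-S8 — `K2E1ChiEisensteinL2BoundRegularPointCMThree` (R7₃ FILE A): THE TRUNCATED `L²` FAMILY IS BOUNDED NEAR EVERY REGULAR POINT OF THE SCALARS — the ★ middle-pole
# Maass–Selberg chain with the pole data replaced by REGULAR data

Cell `pub/hodgecm-mathlib`, crux H413 = `stmt-HodgeConjecture-24833`, route `HCCMUnconditional`; R90-TF section S8, deal S8-R202.  THEOREMS ONLY (no `def`, no `instance`, no notation,
no named-fact hypothesis, no `sorry`; default heartbeats); lane `--supports stmt-HodgeConjecture-24833 --as helper` (count-neutral).  Closes no socket.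

THE MATHEMATICS ([MoeglinWaldspurger1995, IV.2.3, IV.3.12]; [Arthur1980TraceFormulaII, §4]; [Langlands1976, §7]).  «The poles of `E(φ_z)` in `{1 < Re}` are among the poles of its
constant term» [MW95 IV.1.11, IV.3.12]: in the `L²` currency of the operator road this is the DIAGONAL MAASS–SELBERG RELATION `‖Λ^T Ẽ(z)‖² = R_χ(z; a, w z, B z z)` with the three
section scalars `a = κ‖φ‖²`, `w z = [χ₁ʷ·conj χ₁·⟨φ̃_z, φ⟩_K]`, `B z z = κ‖φ̃_z‖²` (★ p862892 on the two quarter planes, from the tube formula ★ p863423 by the two-variable identity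
theorem).  The two middle summands carry `1∕|Im z|` but recombine to `(conj k − k)∕(z − z̄)`, `k = T^{−(z−z̄)}·w z`, of norm `|Im k|∕|Im z|` (★ `norm_chiFourTerm_le`); at a point `z₀`,
`1 < Re z₀`, where `w` is ANALYTIC (no pole) and — if `z₀` is real — REAL on the punctured real trace, `k` is `ℝ`-`C¹` and real on the axis, so `|Im k| ≤ C|Im z|` (★ FILE 1
`exists_abs_im_div_le`); the outer coefficients are bounded (★ `exists_norm_outer_le`); hence `‖R_χ(z)‖ ≤ C` off the axis near `z₀` as soon as `B z z` is bounded there (§1).  With the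
relation letter this bounds `‖F z‖` off the axis, and continuity closes across the axis (★ `eventually_norm_le_of_im_ne_zero`) (§2).  §3 is ★ `msBound_middlePole_of_tube_letters_free`
(R90S8ResGMidBlockMSRoadOfLettersU3 §0) BYTE-PARALLEL with `3∕2 ↦ (z₀ : ℝ)`, `1 < z₀`, and the pole data (L3) `hd hdw hβB`-weighted replaced by REGULAR data (L3′)
`(hwa : AnalyticAt ℂ wc z₀) (hreal) (hβB : ‖Bc z z‖ ≤ B near z₀)`: conclusion `∃ C, ∀ᶠ z in 𝓝[≠] z₀, ‖F z‖ ≤ C` — the (MS-P′) letter `hMSP` of ★ p16 `hbddPK_of_letters_cm_three` at a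
REAL candidate pole, in the `‖Fam z‖` currency (FILE B `K2E1ChiEisensteinRealAxisPoleLedgerCMThree` instantiates at the exports' level and reduces (L3′) to «`qc_j` analytic at `z₀`»).
* §1 **`exists_norm_chiFourTerm_le_of_analyticAt`** (generic; any `z₀` with `1 < Re z₀`).
* §2 **`msBound_regular_of_chiRelation`** (generic Banach-valued `F`; twin of ★ `msBound_of_chiRelation` WITHOUT the weight `(z − z₀)`).
* §3 **`msBound_regular_of_tube_letters_free`** (the CM pair, `N = 3`: tube letters → the bound at a regular real `z₀ > 1`).
HONEST LABEL: HC_CM is proved only modulo the 7 printed citations (2 remaining named inputs: hLiu418 = `stmt-HodgeConjecture-24832`, h413 = `stmt-HodgeConjecture-24833`) until rung 0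
closes; this file asserts no named fact and closes no socket; §3 is CONDITIONAL on (L1) the domain package + family, (L2) the continued scalars, (L3′) the regular data (`hwa`, `hreal`,
`hβB`) — visible binders; count-neutral.

## References
* [MoeglinWaldspurger1995] C. Mœglin, J.-L. Waldspurger, *Spectral Decomposition and Eisenstein Series* (1995), IV.1.11, IV.2.3, IV.3.12 (a).
* [Arthur1980TraceFormulaII] J. Arthur, *A trace formula for reductive groups II*, Compositio Math. 40 (1980), §4.
* [Langlands1976] R. P. Langlands, *On the Functional Equations Satisfied by Eisenstein Series*, LNM 544 (1976), §7.
-/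

set_option autoImplicit false
set_option linter.dupNamespace false  -- the mandated namespace repeats the summit's segment (`HodgeConjecture.HodgeConjecture`)

noncomputable section

open MeasureTheory Measure NumberField IsDedekindDomain Set Filter Topology
open scoped ENNReal NNReal ComplexConjugate InnerProductSpace
open Literature.MeasureTheory.Group Literature.NumberTheory Literature.NumberTheory.Automorphic Literature.NumberTheory.Automorphic.UnitaryGroup Literature.NumberTheory.GaloisRepresentations AdelicGroupData
open Literature.NumberTheory.Automorphic.Arthur2013.Leaves.TECR Literature.NumberTheory.Rogawski1990
open Summit.HodgeConjecture.HodgeConjecture.Cruxes.H413.K2E1BorelEisensteinU Summit.HodgeConjecture.HodgeConjecture.Cruxes.H413.K2E1CharacterEisensteinU2Defs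
open Summit.HodgeConjecture.HodgeConjecture.Cruxes.H413.K2E1CharacterEisensteinU3PairDefs Summit.HodgeConjecture.HodgeConjecture.Cruxes.H413.K2E1BLBorelSpacesU2Defs
open Summit.HodgeConjecture.HodgeConjecture.Cruxes.H413.K2E1MaassSelbergDiagonalRealAxisCMThree (exists_norm_outer_le exists_abs_im_div_le eventually_norm_le_of_im_ne_zero)
open Summit.HodgeConjecture.HodgeConjecture.Cruxes.H413.K2E1ChiEisensteinL2BoundMiddlePoleCMThree (norm_chiFourTerm_le)
open Summit.HodgeConjecture.HodgeConjecture.Cruxes.H413.K2E1ChiMaassSelbergDiagonalCMThree (msRel_of_tube_letters)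
open Summit.HodgeConjecture.HodgeConjecture.Cruxes.H413.K2E1ChiMaassSelbergTubeFreeCMThree (maassSelberg_chiPair_cm_three_self_free)

namespace Summit.HodgeConjecture.HodgeConjecture.Cruxes.H413.K2E1ChiEisensteinL2BoundRegularPointCMThree

/-! ## §1 The χ diagonal four-term is bounded near a regular point of the scalars -/

section Generic

/-- **THE χ DIAGONAL FOUR-TERM IS BOUNDED NEAR EVERY `z₀` WITH `1 < Re z₀` AT WHICH `w` IS ANALYTIC** (off the real axis; if `z₀` is real, `w` is asked to be real at the real points
`x ≠ Re z₀` near it — the reflection principle) **AND `β` IS BOUNDED**: the `1∕|Im z|` of the two middle summands cancels (★ `norm_chiFourTerm_le` + ★ `exists_abs_im_div_le`), the outer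
coefficients are continuous on `{1 < Re}` (★ `exists_norm_outer_le`).  Three-scalar, pole-free twin of ★ `exists_norm_fourTerm_diag_le`. [cite: MoeglinWaldspurger1995, IV.2.3, IV.3.12 (a)]
[cite: Arthur1980TraceFormulaII, §4] -/
theorem exists_norm_chiFourTerm_le_of_analyticAt (Cμ CK a : ℝ) {T : ℝ} (hT : 0 < T) {w β : ℂ → ℂ} {z₀ : ℂ} (hz₀ : 1 < z₀.re)
    (hw : AnalyticAt ℂ w z₀) (hreal : z₀.im = 0 → ∀ᶠ x : ℝ in 𝓝[≠] z₀.re, (w (x : ℂ)).im = 0) (hβ : ∃ B : ℝ, ∀ᶠ z in 𝓝[≠] z₀, ‖β z‖ ≤ B) :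
    ∃ C : ℝ, ∀ᶠ z in 𝓝[≠] z₀, z.im ≠ 0 →
      ‖((Cμ : ℝ) : ℂ) * (((CK : ℝ) : ℂ) *
        ((((T : ℝ) : ℂ) ^ (z + conj z - 2) / (z + conj z - 2)) * ((a : ℝ) : ℂ)
          + (((T : ℝ) : ℂ) ^ (z - conj z) / (z - conj z)) * conj (w z)
          - (((T : ℝ) : ℂ) ^ (-(z - conj z)) / (z - conj z)) * w z
          - (((T : ℝ) : ℂ) ^ (-(z + conj z - 2)) / (z + conj z - 2)) * β z))‖ ≤ C := by
  obtain ⟨B, hB⟩ := exists_norm_outer_le hT hz₀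
  obtain ⟨C₁, hC₁⟩ := exists_abs_im_div_le hT (hw.contDiffAt.restrict_scalars ℝ) hreal
  obtain ⟨Bβ, hBβ⟩ := hβ
  refine ⟨‖((Cμ : ℝ) : ℂ) * ((CK : ℝ) : ℂ)‖ * (B * |a| + C₁ + B * Bβ), ?_⟩
  filter_upwards [mem_nhdsWithin_of_mem_nhds hB, mem_nhdsWithin_of_mem_nhds hC₁, hBβ] with z hzB hzC hzβ hzim
  refine (norm_chiFourTerm_le Cμ CK a hT (w z) (β z) z).trans (mul_le_mul_of_nonneg_left ?_ (norm_nonneg _))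
  have hB0 : 0 ≤ B := (norm_nonneg _).trans hzB.1
  exact add_le_add (add_le_add (mul_le_mul_of_nonneg_right hzB.1 (abs_nonneg a)) (hzC hzim)) (mul_le_mul hzB.2 hzβ (norm_nonneg _) hB0)

/-! ## §2 The bound on the family from the relation letter, any Banach space -/

/-- **THE TRUNCATED FAMILY IS BOUNDED NEAR A REGULAR POINT, OF THE RELATION LETTER** (twin of ★ `msBound_of_chiRelation` WITHOUT the weight `(z − z₀)`): if `‖F z‖² ≤ ‖R_χ(z; a, w z, β z)‖`
off the real axis near `z₀` (`1 < Re z₀`), `w` is analytic at `z₀` (real on the punctured real trace when `z₀` is real), `β` is bounded near `z₀`, and `F` is continuous on an open `V`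
containing a punctured neighbourhood of `z₀`, then `‖F z‖ ≤ C` on a punctured neighbourhood of `z₀` (§1 off the axis; continuity across it, ★ `eventually_norm_le_of_im_ne_zero`).
[cite: MoeglinWaldspurger1995, IV.2.3, IV.3.12 (a)] [cite: Langlands1976, §7] -/
theorem msBound_regular_of_chiRelation {X : Type*} [NormedAddCommGroup X] [NormedSpace ℂ X] (F : ℂ → X) {V : Set ℂ} (hV : IsOpen V) {z₀ : ℂ} (hz₀ : 1 < z₀.re)
    (hVmem : ∀ᶠ z in 𝓝[≠] z₀, z ∈ V) (hFc : ContinuousOn F V)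
    (Cμ CK a : ℝ) {T : ℝ} (hT : 0 < T) {w β : ℂ → ℂ}
    (hw : AnalyticAt ℂ w z₀) (hreal : z₀.im = 0 → ∀ᶠ x : ℝ in 𝓝[≠] z₀.re, (w (x : ℂ)).im = 0) (hβ : ∃ B : ℝ, ∀ᶠ z in 𝓝[≠] z₀, ‖β z‖ ≤ B)
    (hMSrel : ∀ᶠ z in 𝓝[≠] z₀, z.im ≠ 0 →
      ‖F z‖ ^ 2 ≤ ‖((Cμ : ℝ) : ℂ) * (((CK : ℝ) : ℂ) *
        ((((T : ℝ) : ℂ) ^ (z + conj z - 2) / (z + conj z - 2)) * ((a : ℝ) : ℂ)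
          + (((T : ℝ) : ℂ) ^ (z - conj z) / (z - conj z)) * conj (w z)
          - (((T : ℝ) : ℂ) ^ (-(z - conj z)) / (z - conj z)) * w z
          - (((T : ℝ) : ℂ) ^ (-(z + conj z - 2)) / (z + conj z - 2)) * β z))‖) :
    ∃ C : ℝ, ∀ᶠ z in 𝓝[≠] z₀, ‖F z‖ ≤ C := by
  obtain ⟨C, hC⟩ := exists_norm_chiFourTerm_le_of_analyticAt Cμ CK a hT hz₀ hw hreal hβ
  have hC0 : ∀ᶠ z in 𝓝[≠] z₀, z.im ≠ 0 → ‖F z‖ ≤ Real.sqrt C := by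
    filter_upwards [hC, hMSrel] with z hz hrel hzim
    exact Real.le_sqrt_of_sq_le ((hrel hzim).trans (hz hzim))
  exact ⟨Real.sqrt C, eventually_norm_le_of_im_ne_zero hV hFc hVmem hC0⟩

end Generic

/-! ## §3 From the tube letters: the bound at a regular real point (★ §0 of the MS road, byte-parallel) -/

section Free
variable (L : Type) [Field L] [NumberField L] [IsCMField L] [MeasurableSpace (quasiSplit (↥(maximalRealSubfield L)) L (IsCMField.complexConj L) 3).Adelic] [BorelSpace (quasiSplit (↥(maximalRealSubfield L)) L (IsCMField.complexConj L) 3).Adelic]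
  [MeasurableSpace (AdeleRing (𝓞 L) L)ˣ] [BorelSpace (AdeleRing (𝓞 L) L)ˣ]

/-- **THE TRUNCATED `L²` FAMILY IS BOUNDED NEAR A REGULAR REAL POINT `z₀ > 1`, OF THE TUBE LETTERS** — ★ `msBound_middlePole_of_tube_letters_free` with `3∕2 ↦ z₀` and the pole data
replaced by REGULAR data: for the χ-pair section `φ`, the normalised structural data, (L1) the `L²`-family `F` on the two quarter-plane domains (holomorphic there, continuous on `V`, equal
to `[Λ^T E(φ_z)]` on their tube parts), (L2) the continued scalars `wc`, `Bc` (holomorphic on the domains, agreeing with the intertwining integrals on the tube), (L3′) `wc` ANALYTIC at `z₀`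
and real on the punctured real trace, `Bc z z` bounded near `z₀`:  `∃ C, ∀ᶠ z in 𝓝[≠] z₀, ‖F z‖ ≤ C` (★ p863423 tube formula → ★ p862892 `msRel_of_tube_letters z₀` → §2).
[cite: MoeglinWaldspurger1995, IV.1.11, IV.2.3, IV.3.12 (a)] [cite: Arthur1980TraceFormulaII, §4] [cite: Langlands1976, §7] -/
theorem msBound_regular_of_tube_letters_free
    (μ : Measure (quasiSplit (↥(maximalRealSubfield L)) L (IsCMField.complexConj L) 3).automorphicQuotient) [(quasiSplit (↥(maximalRealSubfield L)) L (IsCMField.complexConj L) 3).IsAutomorphicMeasure μ]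
    (νG : Measure (quasiSplit (↥(maximalRealSubfield L)) L (IsCMField.complexConj L) 3).Adelic) [νG.IsHaarMeasure] [νG.IsInvInvariant]
    (μK : Measure ((standardMaximalCompactGL 3 L).comap (adelicVal (↥(maximalRealSubfield L)) L (IsCMField.complexConj L) 3 ((StdForm.antidiagonal 3).over L)) : Subgroup (quasiSplit (↥(maximalRealSubfield L)) L (IsCMField.complexConj L) 3).Adelic))
    [μK.IsHaarMeasure]
    (νI : Measure (AdeleRing (𝓞 L) L)ˣ) [νI.IsHaarMeasure]
    {𝓕I : Set (AdeleRing (𝓞 L) L)ˣ} (h𝓕I : IsIdeleClassDomain L 𝓕I)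
    (ν : Measure ↥(adelicUnipotent (↥(maximalRealSubfield L)) L (IsCMField.complexConj L) 3)) [ν.IsHaarMeasure] [ν.IsInvInvariant]
    {𝓕 : Set ↥(adelicUnipotent (↥(maximalRealSubfield L)) L (IsCMField.complexConj L) 3)} (h𝓕N : IsFundamentalDomain ↥(rationalUnipotent (↥(maximalRealSubfield L)) L (IsCMField.complexConj L) 3) 𝓕 ν) (h𝓕1 : ν 𝓕 = 1)
    (h𝓕c : IsCompact (closure 𝓕))
    {β : (quasiSplit (↥(maximalRealSubfield L)) L (IsCMField.complexConj L) 3).Adelic → ℝ≥0∞} (hβ : IsCoveringWeight ((arithmeticBorel (↥(maximalRealSubfield L)) L (IsCMField.complexConj L) 3).map (quasiSplit (↥(maximalRealSubfield L)) L (IsCMField.complexConj L) 3).arithmeticSubgroup.subtype) β)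
    {T : ℝ≥0} (hT : 1 ≤ T)
    {χ₁ : HeckeCharacter L} {χ₂ : ↥(TorusDict.torus (IsCMField.complexConj L)) →ₜ* ℂˣ}
    (hχ₁ : χ₁.IsUnitary) (hρ₁ : ∀ r : ℝ≥0ˣ, χ₁ (posRealIdele L r) = 1) (hχ₂u : ∀ u, ‖((χ₂ u : ℂˣ) : ℂ)‖ = 1) (hχ₂ : TorusDict.IsAutomorphic (IsCMField.complexConj L) χ₂)
    {φ : (quasiSplit (↥(maximalRealSubfield L)) L (IsCMField.complexConj L) 3).Adelic → ℂ} (hφc : Continuous φ) (hφ : IsChiSectionPair χ₁ χ₂ φ) {Cφ : ℝ} (hφC : ∀ x, ‖φ x‖ ≤ Cφ)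
    -- (L1) the domain package and the continued `L²`-family
    {D₁ : Set ℂ} (hD₁ : IsOpen D₁) (hD₁c : IsPreconnected D₁) (hD₁sub : D₁ ⊆ {z : ℂ | 1 < z.re ∧ 0 < z.im})
    {O₁ O₂' : Set ℂ} (hO₁ : IsOpen O₁) (hO₁ne : O₁.Nonempty) (hO₁D : O₁ ⊆ D₁) (hO₂' : IsOpen O₂') (hO₂'ne : O₂'.Nonempty) (hO₂'D : O₂' ⊆ D₁)
    (hsep : ∀ z ∈ O₁, ∀ z' ∈ O₂', 2 < z'.re ∧ z'.re < z.re)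
    {D₂ : Set ℂ} (hD₂ : IsOpen D₂) (hD₂c : IsPreconnected D₂) (hD₂sub : D₂ ⊆ {z : ℂ | 1 < z.re ∧ z.im < 0})
    {Q₁ Q₂' : Set ℂ} (hQ₁ : IsOpen Q₁) (hQ₁ne : Q₁.Nonempty) (hQ₁D : Q₁ ⊆ D₂) (hQ₂' : IsOpen Q₂') (hQ₂'ne : Q₂'.Nonempty) (hQ₂'D : Q₂' ⊆ D₂)
    (hsep₂ : ∀ z ∈ Q₁, ∀ z' ∈ Q₂', 2 < z'.re ∧ z'.re < z.re)
    {z₀ : ℝ} (hz₀ : 1 < z₀) (hD₁ev : ∀ᶠ z : ℂ in 𝓝[≠] (z₀ : ℂ), 0 < z.im → z ∈ D₁) (hD₂ev : ∀ᶠ z : ℂ in 𝓝[≠] (z₀ : ℂ), z.im < 0 → z ∈ D₂)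
    (F : ℂ → Lp ℂ 2 μ) (hFd₁ : DifferentiableOn ℂ F D₁) (hFd₂ : DifferentiableOn ℂ F D₂)
    {V : Set ℂ} (hV : IsOpen V) (hVmem : ∀ᶠ z in 𝓝[≠] (z₀ : ℂ), z ∈ V) (hFc : ContinuousOn F V)
    (hFtube₁ : (∀ z ∈ D₁, 2 < z.re → ((F z : Lp ℂ 2 μ) : (quasiSplit (↥(maximalRealSubfield L)) L (IsCMField.complexConj L) 3).automorphicQuotient → ℂ) =ᵐ[μ] (quasiSplit (↥(maximalRealSubfield L)) L (IsCMField.complexConj L) 3).quotFun (truncation ν 𝓕 T (eisensteinSeriesU (flatSectionU φ z)))))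
    (hFtube₂ : (∀ z ∈ D₂, 2 < z.re → ((F z : Lp ℂ 2 μ) : (quasiSplit (↥(maximalRealSubfield L)) L (IsCMField.complexConj L) 3).automorphicQuotient → ℂ) =ᵐ[μ] (quasiSplit (↥(maximalRealSubfield L)) L (IsCMField.complexConj L) 3).quotFun (truncation ν 𝓕 T (eisensteinSeriesU (flatSectionU φ z)))))
    -- (L2) the continued scalars: holomorphy on the domains and agreement with the intertwining integrals on the tube
    {wc : ℂ → ℂ} (hwc₁ : DifferentiableOn ℂ wc D₁) (hwc₂ : DifferentiableOn ℂ wc D₂)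
    (hwagree : ∀ s : ℂ, 2 < s.re → wc s = ∫ x in {x : (AdeleRing (𝓞 L) L)ˣ | (IdeleClassGroup.ideleNorm L x : ℝ) ≤ 1} ∩ 𝓕I, ((IdeleClassGroup.ideleNorm L x : ℝ) : ℂ) * (((reflectChar (IsCMField.complexConj L) χ₁ x : ℂˣ) : ℂ) * conj ((χ₁ x : ℂˣ) : ℂ) * (∫ k, (fun g : (quasiSplit (↥(maximalRealSubfield L)) L (IsCMField.complexConj L) 3).Adelic => (∫ v : ↥(adelicUnipotent (↥(maximalRealSubfield L)) L (IsCMField.complexConj L) 3), flatSectionU φ s ((quasiSplit (↥(maximalRealSubfield L)) L (IsCMField.complexConj L) 3).toAdelic (weylLongU ((IsCMField.complexConj L : L ≃ₐ[↥(maximalRealSubfield L)] L) : L →+* L) (rfl : (StdForm.antidiagonal 3).over L = (StdForm.antidiagonal 3).over L)) * ((v : (quasiSplit (↥(maximalRealSubfield L)) L (IsCMField.complexConj L) 3).Adelic) * g)) ∂ν) * ((borelHeight g : ℝ) : ℂ) ^ (s - 2)) (k : (quasiSplit (↥(maximalRealSubfield L)) L (IsCMField.complexConj L) 3).Adelic)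 * conj (φ (k : (quasiSplit (↥(maximalRealSubfield L)) L (IsCMField.complexConj L) 3).Adelic)) ∂μK)) ∂νI)
    {Bc : ℂ → ℂ → ℂ} (hBc₁ : ∀ z' ∈ D₁, DifferentiableOn ℂ (fun z : ℂ => Bc z z') D₁) (hBc₂ : ∀ z ∈ D₁, DifferentiableOn ℂ (fun u : ℂ => Bc z (conj u)) {u : ℂ | conj u ∈ D₁})
    (hBc₁' : ∀ z' ∈ D₂, DifferentiableOn ℂ (fun z : ℂ => Bc z z') D₂) (hBc₂' : ∀ z ∈ D₂, DifferentiableOn ℂ (fun u : ℂ => Bc z (conj u)) {u : ℂ | conj u ∈ D₂})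
    (hBagree : ∀ s s' : ℂ, 2 < s.re → 2 < s'.re → Bc s s' = (∫ x in {x : (AdeleRing (𝓞 L) L)ˣ | (IdeleClassGroup.ideleNorm L x : ℝ) ≤ 1} ∩ 𝓕I, ((IdeleClassGroup.ideleNorm L x : ℝ) : ℂ) ∂νI) * (∫ k, (fun g : (quasiSplit (↥(maximalRealSubfield L)) L (IsCMField.complexConj L) 3).Adelic => (∫ v : ↥(adelicUnipotent (↥(maximalRealSubfield L)) L (IsCMField.complexConj L) 3), flatSectionU φ s ((quasiSplit (↥(maximalRealSubfield L)) L (IsCMField.complexConj L) 3).toAdelic (weylLongU ((IsCMField.complexConj L : L ≃ₐ[↥(maximalRealSubfield L)] L) : L →+* L) (rfl : (StdForm.antidiagonal 3).over L = (StdForm.antidiagonal 3).over L)) * ((v : (quasiSplit (↥(maximalRealSubfield L)) L (IsCMField.complexConj L) 3).Adelic) * g)) ∂ν) * ((borelHeight g : ℝ) : ℂ) ^ (s - 2)) (k : (quasiSplit (↥(maximalRealSubfield L)) L (IsCMField.complexConj L) 3).Adelic) * conj ((fun g : (quasiSplit (↥(maximalRealSubfield L)) L (IsCMField.complexConj L)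 3).Adelic => (∫ v : ↥(adelicUnipotent (↥(maximalRealSubfield L)) L (IsCMField.complexConj L) 3), flatSectionU φ s' ((quasiSplit (↥(maximalRealSubfield L)) L (IsCMField.complexConj L) 3).toAdelic (weylLongU ((IsCMField.complexConj L : L ≃ₐ[↥(maximalRealSubfield L)] L) : L →+* L) (rfl : (StdForm.antidiagonal 3).over L = (StdForm.antidiagonal 3).over L)) * ((v : (quasiSplit (↥(maximalRealSubfield L)) L (IsCMField.complexConj L) 3).Adelic) * g)) ∂ν) * ((borelHeight g : ℝ) : ℂ) ^ (s' - 2)) (k : (quasiSplit (↥(maximalRealSubfield L)) L (IsCMField.complexConj L) 3).Adelic)) ∂μK))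
    -- (L3′) REGULAR data at `z₀`: `wc` analytic at `z₀` and real on the punctured real trace, the diagonal kernel bounded
    (hwa : AnalyticAt ℂ wc (z₀ : ℂ)) (hreal : ∀ᶠ x : ℝ in 𝓝[≠] z₀, (wc (x : ℂ)).im = 0)
    (hβB : ∃ B : ℝ, ∀ᶠ z in 𝓝[≠] (z₀ : ℂ), ‖Bc z z‖ ≤ B) :
    ∃ C : ℝ, ∀ᶠ z in 𝓝[≠] (z₀ : ℂ), ‖F z‖ ≤ C := by
  have hT0 : (0 : ℝ) < (T : ℝ) := by exact_mod_cast (zero_lt_one.trans_le hT)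
  obtain ⟨Cμ, CK, _, _, h⟩ := maassSelberg_chiPair_cm_three_self_free L μ νG μK νI h𝓕I ν h𝓕N h𝓕1 h𝓕c
  have hU : ∀ {D : Set ℂ}, (∀ z ∈ D, 2 < z.re → ((F z : Lp ℂ 2 μ) : (quasiSplit (↥(maximalRealSubfield L)) L (IsCMField.complexConj L) 3).automorphicQuotient → ℂ) =ᵐ[μ] (quasiSplit (↥(maximalRealSubfield L)) L (IsCMField.complexConj L) 3).quotFun (truncation ν 𝓕 T (eisensteinSeriesU (flatSectionU φ z)))) →
      ∀ z ∈ D, ∀ z' ∈ D, 2 < z'.re → z'.re < z.re →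
      ⟪F z', F z⟫_ℂ = ((Cμ : ℝ) : ℂ) * (((CK : ℝ) : ℂ) *
        ((((T : ℝ) : ℂ) ^ (z + conj z' - 2) / (z + conj z' - 2)) * ((((∫ x in {x : (AdeleRing (𝓞 L) L)ˣ | (IdeleClassGroup.ideleNorm L x : ℝ) ≤ 1} ∩ 𝓕I, (IdeleClassGroup.ideleNorm L x : ℝ) ∂νI) * (∫ k, ‖φ (k : (quasiSplit (↥(maximalRealSubfield L)) L (IsCMField.complexConj L) 3).Adelic)‖ ^ 2 ∂μK)) : ℝ) : ℂ)
          + (((T : ℝ) : ℂ) ^ (z - conj z') / (z - conj z')) * conj (∫ x in {x : (AdeleRing (𝓞 L) L)ˣ | (IdeleClassGroup.ideleNorm L x : ℝ) ≤ 1} ∩ 𝓕I, ((IdeleClassGroup.ideleNorm L x : ℝ) : ℂ) * (((reflectChar (IsCMField.complexConj L) χ₁ x : ℂˣ) : ℂ) * conj ((χ₁ x : ℂˣ) : ℂ) * (∫ k, (fun g : (quasiSplit (↥(maximalRealSubfield L)) L (IsCMField.complexConj L) 3).Adelic => (∫ v : ↥(adelicUnipotent (↥(maximalRealSubfield L)) L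 (IsCMField.complexConj L) 3), flatSectionU φ z' ((quasiSplit (↥(maximalRealSubfield L)) L (IsCMField.complexConj L) 3).toAdelic (weylLongU ((IsCMField.complexConj L : L ≃ₐ[↥(maximalRealSubfield L)] L) : L →+* L) (rfl : (StdForm.antidiagonal 3).over L = (StdForm.antidiagonal 3).over L)) * ((v : (quasiSplit (↥(maximalRealSubfield L)) L (IsCMField.complexConj L) 3).Adelic) * g)) ∂ν) * ((borelHeight g : ℝ) : ℂ) ^ (z' - 2)) (k : (quasiSplit (↥(maximalRealSubfield L)) L (IsCMField.complexConj L) 3).Adelic) * conj (φ (k : (quasiSplit (↥(maximalRealSubfield L)) L (IsCMField.complexConj L) 3).Adelic)) ∂μK)) ∂νI)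
          - (((T : ℝ) : ℂ) ^ (-(z - conj z')) / (z - conj z')) * (∫ x in {x : (AdeleRing (𝓞 L) L)ˣ | (IdeleClassGroup.ideleNorm L x : ℝ) ≤ 1} ∩ 𝓕I, ((IdeleClassGroup.ideleNorm L x : ℝ) : ℂ) * (((reflectChar (IsCMField.complexConj L) χ₁ x : ℂˣ) : ℂ) * conj ((χ₁ x : ℂˣ) : ℂ) * (∫ k, (fun g : (quasiSplit (↥(maximalRealSubfield L)) L (IsCMField.complexConj L) 3).Adelic => (∫ v : ↥(adelicUnipotent (↥(maximalRealSubfield L)) L (IsCMField.complexConj L) 3), flatSectionU φ z ((quasiSplit (↥(maximalRealSubfield L)) L (IsCMField.complexConj L) 3).toAdelic (weylLongU ((IsCMField.complexConj L : L ≃ₐ[↥(maximalRealSubfield L)] L) : L →+* L) (rfl : (StdForm.antidiagonal 3).over L = (StdForm.antidiagonal 3).over L)) * ((v : (quasiSplit (↥(maximalRealSubfield L)) L (IsCMField.complexConj L) 3).Adelic) * g)) ∂ν) * ((borelHeight g : ℝ) : ℂ) ^ (z - 2)) (k : (quasiSplit (↥(maximalRealSubfield L)) L (IsCMField.complexConj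 L) 3).Adelic) * conj (φ (k : (quasiSplit (↥(maximalRealSubfield L)) L (IsCMField.complexConj L) 3).Adelic)) ∂μK)) ∂νI)
          - (((T : ℝ) : ℂ) ^ (-(z + conj z' - 2)) / (z + conj z' - 2)) * ((∫ x in {x : (AdeleRing (𝓞 L) L)ˣ | (IdeleClassGroup.ideleNorm L x : ℝ) ≤ 1} ∩ 𝓕I, ((IdeleClassGroup.ideleNorm L x : ℝ) : ℂ) ∂νI) * (∫ k, (fun g : (quasiSplit (↥(maximalRealSubfield L)) L (IsCMField.complexConj L) 3).Adelic => (∫ v : ↥(adelicUnipotent (↥(maximalRealSubfield L)) L (IsCMField.complexConj L) 3), flatSectionU φ z ((quasiSplit (↥(maximalRealSubfield L)) L (IsCMField.complexConj L) 3).toAdelic (weylLongU ((IsCMField.complexConj L : L ≃ₐ[↥(maximalRealSubfield L)] L) : L →+* L) (rfl : (StdForm.antidiagonal 3).over L = (StdForm.antidiagonal 3).over L)) * ((v : (quasiSplit (↥(maximalRealSubfield L)) L (IsCMField.complexConj L) 3).Adelic) * g)) ∂ν) * ((borelHeight g : ℝ) : ℂ) ^ (z - 2)) (k : (quasiSplit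 (↥(maximalRealSubfield L)) L (IsCMField.complexConj L) 3).Adelic) * conj ((fun g : (quasiSplit (↥(maximalRealSubfield L)) L (IsCMField.complexConj L) 3).Adelic => (∫ v : ↥(adelicUnipotent (↥(maximalRealSubfield L)) L (IsCMField.complexConj L) 3), flatSectionU φ z' ((quasiSplit (↥(maximalRealSubfield L)) L (IsCMField.complexConj L) 3).toAdelic (weylLongU ((IsCMField.complexConj L : L ≃ₐ[↥(maximalRealSubfield L)] L) : L →+* L) (rfl : (StdForm.antidiagonal 3).over L = (StdForm.antidiagonal 3).over L)) * ((v : (quasiSplit (↥(maximalRealSubfield L)) L (IsCMField.complexConj L) 3).Adelic) * g)) ∂ν) * ((borelHeight g : ℝ) : ℂ) ^ (z' - 2)) (k : (quasiSplit (↥(maximalRealSubfield L)) L (IsCMField.complexConj L) 3).Adelic)) ∂μK)))) := by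
    intro D hFt z hz z' hz' h1 h2
    have hraw : ⟪F z', F z⟫_ℂ = ∫ x, (quasiSplit (↥(maximalRealSubfield L)) L (IsCMField.complexConj L) 3).quotFun (truncation ν 𝓕 T (eisensteinSeriesU (flatSectionU φ z))) x * conj ((quasiSplit (↥(maximalRealSubfield L)) L (IsCMField.complexConj L) 3).quotFun (truncation ν 𝓕 T (eisensteinSeriesU (flatSectionU φ z'))) x) ∂μ := by
      rw [MeasureTheory.L2.inner_def]
      refine integral_congr_ae ?_
      filter_upwards [hFt z hz (h1.trans h2), hFt z' hz' h1] with x hx hx'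
      rw [hx, hx', RCLike.inner_apply, mul_comm]
    have key := h hβ hT hχ₁ hρ₁ hχ₂u hχ₂ hφc hφ hφC hφc hφ hφC h1 h2
    rw [hraw, key]
    have hA : (∫ x in {x : (AdeleRing (𝓞 L) L)ˣ | (IdeleClassGroup.ideleNorm L x : ℝ) ≤ 1} ∩ 𝓕I, ((IdeleClassGroup.ideleNorm L x : ℝ) : ℂ) ∂νI) * (∫ k, φ (k : (quasiSplit (↥(maximalRealSubfield L)) L (IsCMField.complexConj L) 3).Adelic) * conj (φ (k : (quasiSplit (↥(maximalRealSubfield L)) L (IsCMField.complexConj L) 3).Adelic)) ∂μK) = ((((∫ x in {x : (AdeleRing (𝓞 L) L)ˣ | (IdeleClassGroup.ideleNorm L x : ℝ) ≤ 1} ∩ 𝓕I, (IdeleClassGroup.ideleNorm L x : ℝ) ∂νI) * (∫ k, ‖φ (k : (quasiSplit (↥(maximalRealSubfield L)) L (IsCMField.complexConj L) 3).Adelic)‖ ^ 2 ∂μK)) : ℝ) : ℂ) := by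
      have e1 : (∫ x in {x : (AdeleRing (𝓞 L) L)ˣ | (IdeleClassGroup.ideleNorm L x : ℝ) ≤ 1} ∩ 𝓕I, ((IdeleClassGroup.ideleNorm L x : ℝ) : ℂ) ∂νI) = (((∫ x in {x : (AdeleRing (𝓞 L) L)ˣ | (IdeleClassGroup.ideleNorm L x : ℝ) ≤ 1} ∩ 𝓕I, (IdeleClassGroup.ideleNorm L x : ℝ) ∂νI) : ℝ) : ℂ) := integral_complex_ofReal
      have e2 : (∫ k, φ (k : (quasiSplit (↥(maximalRealSubfield L)) L (IsCMField.complexConj L) 3).Adelic) * conj (φ (k : (quasiSplit (↥(maximalRealSubfield L)) L (IsCMField.complexConj L) 3).Adelic)) ∂μK) = (((∫ k, ‖φ (k : (quasiSplit (↥(maximalRealSubfield L)) L (IsCMField.complexConj L) 3).Adelic)‖ ^ 2 ∂μK) : ℝ) : ℂ) := by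
        rw [← integral_complex_ofReal]
        refine integral_congr_ae (Filter.Eventually.of_forall fun k => ?_)
        dsimp only
        rw [Complex.mul_conj, Complex.normSq_eq_norm_sq, Complex.ofReal_pow]
      rw [e1, e2, ← Complex.ofReal_mul]
    have hP : conj (∫ k, (fun g : (quasiSplit (↥(maximalRealSubfield L)) L (IsCMField.complexConj L) 3).Adelic => (∫ v : ↥(adelicUnipotent (↥(maximalRealSubfield L)) L (IsCMField.complexConj L) 3), flatSectionU φ z' ((quasiSplit (↥(maximalRealSubfield L)) L (IsCMField.complexConj L) 3).toAdelic (weylLongU ((IsCMField.complexConj L : L ≃ₐ[↥(maximalRealSubfield L)] L) : L →+* L) (rfl : (StdForm.antidiagonal 3).over L = (StdForm.antidiagonal 3).over L)) * ((v : (quasiSplit (↥(maximalRealSubfield L)) L (IsCMField.complexConj L) 3).Adelic) * g)) ∂ν) * ((borelHeight g : ℝ) : ℂ) ^ (z' - 2)) (k : (quasiSplit (↥(maximalRealSubfield L)) L (IsCMField.complexConj L) 3).Adelic) * conj (φ (k : (quasiSplit (↥(maximalRealSubfield L)) L (IsCMField.complexConj L) 3).Adelic)) ∂μK) = (∫ k,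 φ (k : (quasiSplit (↥(maximalRealSubfield L)) L (IsCMField.complexConj L) 3).Adelic) * conj ((fun g : (quasiSplit (↥(maximalRealSubfield L)) L (IsCMField.complexConj L) 3).Adelic => (∫ v : ↥(adelicUnipotent (↥(maximalRealSubfield L)) L (IsCMField.complexConj L) 3), flatSectionU φ z' ((quasiSplit (↥(maximalRealSubfield L)) L (IsCMField.complexConj L) 3).toAdelic (weylLongU ((IsCMField.complexConj L : L ≃ₐ[↥(maximalRealSubfield L)] L) : L →+* L) (rfl : (StdForm.antidiagonal 3).over L = (StdForm.antidiagonal 3).over L)) * ((v : (quasiSplit (↥(maximalRealSubfield L)) L (IsCMField.complexConj L) 3).Adelic) * g)) ∂ν) * ((borelHeight g : ℝ) : ℂ) ^ (z' - 2)) (k : (quasiSplit (↥(maximalRealSubfield L)) L (IsCMField.complexConj L) 3).Adelic)) ∂μK) := by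
      rw [← integral_conj]
      refine integral_congr_ae (Filter.Eventually.of_forall fun k => ?_)
      dsimp only
      rw [map_mul, Complex.conj_conj, mul_comm]
    have hB : (∫ x in {x : (AdeleRing (𝓞 L) L)ˣ | (IdeleClassGroup.ideleNorm L x : ℝ) ≤ 1} ∩ 𝓕I, ((IdeleClassGroup.ideleNorm L x : ℝ) : ℂ) * (((χ₁ x : ℂˣ) : ℂ) * conj ((reflectChar (IsCMField.complexConj L) χ₁ x : ℂˣ) : ℂ) * (∫ k, φ (k : (quasiSplit (↥(maximalRealSubfield L)) L (IsCMField.complexConj L) 3).Adelic) * conj ((fun g : (quasiSplit (↥(maximalRealSubfield L)) L (IsCMField.complexConj L) 3).Adelic => (∫ v : ↥(adelicUnipotent (↥(maximalRealSubfield L)) L (IsCMField.complexConj L) 3), flatSectionU φ z' ((quasiSplit (↥(maximalRealSubfield L)) L (IsCMField.complexConj L) 3).toAdelic (weylLongU ((IsCMField.complexConj L : L ≃ₐ[↥(maximalRealSubfield L)] L) : L →+* L) (rfl : (StdForm.antidiagonal 3).over L = (StdForm.antidiagonal 3).over L)) * ((v : (quasiSplit (↥(maximalRealSubfield L)) L (IsCMField.complexConj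 L) 3).Adelic) * g)) ∂ν) * ((borelHeight g : ℝ) : ℂ) ^ (z' - 2)) (k : (quasiSplit (↥(maximalRealSubfield L)) L (IsCMField.complexConj L) 3).Adelic)) ∂μK)) ∂νI) = conj (∫ x in {x : (AdeleRing (𝓞 L) L)ˣ | (IdeleClassGroup.ideleNorm L x : ℝ) ≤ 1} ∩ 𝓕I, ((IdeleClassGroup.ideleNorm L x : ℝ) : ℂ) * (((reflectChar (IsCMField.complexConj L) χ₁ x : ℂˣ) : ℂ) * conj ((χ₁ x : ℂˣ) : ℂ) * (∫ k, (fun g : (quasiSplit (↥(maximalRealSubfield L)) L (IsCMField.complexConj L) 3).Adelic => (∫ v : ↥(adelicUnipotent (↥(maximalRealSubfield L)) L (IsCMField.complexConj L) 3), flatSectionU φ z' ((quasiSplit (↥(maximalRealSubfield L)) L (IsCMField.complexConj L) 3).toAdelic (weylLongU ((IsCMField.complexConj L : L ≃ₐ[↥(maximalRealSubfield L)] L) : L →+* L) (rfl : (StdForm.antidiagonal 3).over L = (StdForm.antidiagonal 3).over L)) * ((v : (quasiSplit (↥(maximalRealSubfield L)) L (IsCMField.complexConj L) 3).Adelic) *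 g)) ∂ν) * ((borelHeight g : ℝ) : ℂ) ^ (z' - 2)) (k : (quasiSplit (↥(maximalRealSubfield L)) L (IsCMField.complexConj L) 3).Adelic) * conj (φ (k : (quasiSplit (↥(maximalRealSubfield L)) L (IsCMField.complexConj L) 3).Adelic)) ∂μK)) ∂νI) := by
      rw [← integral_conj]
      refine integral_congr_ae (Filter.Eventually.of_forall fun x => ?_)
      simp only [map_mul, Complex.conj_ofReal, Complex.conj_conj, hP]
      ring
    rw [hA, hB]
  have hMStube : ∀ {D : Set ℂ}, (∀ z ∈ D, 2 < z.re → ((F z : Lp ℂ 2 μ) : (quasiSplit (↥(maximalRealSubfield L)) L (IsCMField.complexConj L) 3).automorphicQuotient → ℂ) =ᵐ[μ] (quasiSplit (↥(maximalRealSubfield L)) L (IsCMField.complexConj L) 3).quotFun (truncation ν 𝓕 T (eisensteinSeriesU (flatSectionU φ z)))) →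
      ∀ z ∈ D, ∀ z' ∈ D, 2 < z'.re → z'.re < z.re →
      ⟪F z', F z⟫_ℂ = ((Cμ : ℝ) : ℂ) * (((CK : ℝ) : ℂ) *
        ((((T : ℝ) : ℂ) ^ (z + conj z' - 2) / (z + conj z' - 2)) * ((((∫ x in {x : (AdeleRing (𝓞 L) L)ˣ | (IdeleClassGroup.ideleNorm L x : ℝ) ≤ 1} ∩ 𝓕I, (IdeleClassGroup.ideleNorm L x : ℝ) ∂νI) * (∫ k, ‖φ (k : (quasiSplit (↥(maximalRealSubfield L)) L (IsCMField.complexConj L) 3).Adelic)‖ ^ 2 ∂μK)) : ℝ) : ℂ)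
          + (((T : ℝ) : ℂ) ^ (z - conj z') / (z - conj z')) * conj (wc z')
          - (((T : ℝ) : ℂ) ^ (-(z - conj z')) / (z - conj z')) * wc z
          - (((T : ℝ) : ℂ) ^ (-(z + conj z' - 2)) / (z + conj z' - 2)) * Bc z z')) := by
    intro D hFt z hz z' hz' h1 h2
    rw [hU hFt z hz z' hz' h1 h2, hwagree z (h1.trans h2), hwagree z' h1, hBagree z z' (h1.trans h2) h1]
  have hrel := msRel_of_tube_letters z₀ hD₁ hD₁c hD₁sub hO₁ hO₁ne hO₁D hO₂' hO₂'ne hO₂'D hsep hD₂ hD₂c hD₂sub hQ₁ hQ₁ne hQ₁D hQ₂' hQ₂'ne hQ₂'D hsep₂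
    hD₁ev hD₂ev Cμ CK ((∫ x in {x : (AdeleRing (𝓞 L) L)ˣ | (IdeleClassGroup.ideleNorm L x : ℝ) ≤ 1} ∩ 𝓕I, (IdeleClassGroup.ideleNorm L x : ℝ) ∂νI) * (∫ k, ‖φ (k : (quasiSplit (↥(maximalRealSubfield L)) L (IsCMField.complexConj L) 3).Adelic)‖ ^ 2 ∂μK)) hT0 hwc₁ hwc₂ hBc₁ hBc₂ hBc₁' hBc₂' F hFd₁ hFd₂ (hMStube hFtube₁) (hMStube hFtube₂)
  have hz₀' : 1 < ((z₀ : ℂ)).re := by rwa [Complex.ofReal_re]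
  exact msBound_regular_of_chiRelation F hV hz₀' hVmem hFc Cμ CK ((∫ x in {x : (AdeleRing (𝓞 L) L)ˣ | (IdeleClassGroup.ideleNorm L x : ℝ) ≤ 1} ∩ 𝓕I, (IdeleClassGroup.ideleNorm L x : ℝ) ∂νI) * (∫ k, ‖φ (k : (quasiSplit (↥(maximalRealSubfield L)) L (IsCMField.complexConj L) 3).Adelic)‖ ^ 2 ∂μK)) hT0 (w := wc) (β := fun z => Bc z z)
    hwa (fun _ => by rwa [Complex.ofReal_re]) hβB hrel

end Free

end Summit.HodgeConjecture.HodgeConjecture.Cruxes.H413.K2E1ChiEisensteinL2BoundRegularPointCMThree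

end
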